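import Summits.BirchSwinnertonDyer.Rank1Residual.Partition.MainConjecturesEisensteinHeegner
import Summits.BirchSwinnertonDyer.Rank1Residual.Partition.TamagawaBaseChangeOdd
import Summits.BirchSwinnertonDyer.Rank1Residual.Partition.GrossZagierTwistValuation
import Literature.NumberTheory.EllipticCurves.CastellaGrossiLeeSkinner2022.RankOneTwistIdentity
import HarnessLib

/-!
# CGLS22, proof of Thm. 5.3.1: display (5.7) DERIVED in the kernel from display (5.5) — the step
# "(5.5) + (5.6) [Gross–Zagier] ⇒ (5.7)" with the Manin constant cancelling, at every odd `p`

HONEST FRAMING (cell `b2b-bsdres`, run/shared/lean/b2b/bsd-rank1-residual/; verbatim): the goal is to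
DELETE the COMBINATION-SHAPED residual classes for ALL analytic-rank `≤ 1` curves over `ℚ` — "full BSD
formula for every rank `≤ 1` curve in class `C`" assembled STRICTLY from published theorems — so
that the rank-`≤ 1` remainder becomes exactly the CONSTRUCTION-SHAPED classes, which are TYPED
(missing-input `Prop`s), NOT attempted; this is not "finishing BSD". NEW WORK of the cell (bookkeeping
over decls already in the tree), hence under `Summits/`; NO definition, NO named fact, nothing about
any particular curve asserted; no label moves (row C6 is COVERED [PUB] by CGS 2025 Thm. D, A47).
Unit `b2b-bsdres-lit-cgls` (off-peak literature typer: Castella–Grossi–Lee–Skinner 2022 /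
Greenberg–Vatsal 2000), session 4.

## What this file does

The cell's registry holds TWO displays of the proof of CGLS22 Thm. 5.3.1 as named facts:
A157 = (5.5) (`CastellaGrossiLeeSkinner2022.display55_sha_heegnerIndex`, the Heegner-index identity
OVER `K`, Manin constant `c_E` kept) and A149 = (5.7) (`…display57_rankOne_twist`, the rank-one /
rank-zero twist identity OVER `ℚ`, AFTER Gross–Zagier; reading note `CGLS22-(5.7)-sign`). In print,
(5.7) is OBTAINED from (5.5): "Since `Ш(E/K)[p^∞] ≃ Ш(E/ℚ)[p^∞] ⊕ Ш(E^K/ℚ)[p^∞]` as `p` is odd, and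
`Σ_{w∣ℓ} ord_p(c_w(E/K)) = ord_p(c_ℓ(E/ℚ)) + ord_p(c_ℓ(E^K/ℚ))` for any prime `ℓ`, combining (5.5)
and (5.6) [the Gross–Zagier formula rewritten as `L'(E,1)/(Reg·Ω_E) · L(E^K,1)/Ω_{E^K} =
2^t c_E⁻² u_K⁻² [E(K):ℤ.P_K]²` up to the torsion index] we arrive at (5.7)". This file carries out
exactly that step IN THE KERNEL, for every odd `p` (the Manin constant cancels between (5.5) and
(5.6), so no `p ∤ c_E` is needed and no optimal-curve detour):

1. `TwistIdentity.padicValRat_add_eq_of_grossZagier` — **(5.6), `p`-adically, for ANY elliptic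
   `E/ℚ` with `ord_{s=1}L(E,s) = 1`** (no reducibility, no Eisenstein hypothesis): at a Heegner datum
   `(Dt, H, ι, P)` of level `N = N_E` over an imaginary quadratic `K` (Heegner hypothesis,
   `L(E^{(d_K)},1) ≠ 0`), for the rationals `q = L'(E,1)/(Ω_E Reg)` and `q_d = L(E^{(d_K)},1)/Ω`,
   `ord_p q + ord_p q_d = 2·ord_p [E(K):ℤP] − 2·ord_p c(Dt) − 2·ord_p #E(K)_tors` (`p` odd,
   `p ∤ #𝓞_K^×`, `ord_p u(Cd) = 0` for the chosen minimal model of the twist). Inputs: Gross–Zagier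
   (`gross_zagier`), Kolyvagin (`kolyvagin`; rank `E(K) = 1`), GZK over `ℚ`, modularity (Artin
   formalism `L(E/K,s) = L(E,s)L(E^K,s)`), the period relation and the height–index relation — the
   real-number algebra is the transcript of `X11b.bsdp_of_indexIdentityAt` (multr1-p2) /
   `KrizLi2019/SexticTwistBSDThreeDescent`, stopped one step earlier (before the identity over `K`
   is inserted).
2. `TwistIdentity.display57_at_of_display55` — at a datum: (5.5) + item 1 + the odd parts of `Ш` and
   of the torsion under `K/ℚ` + the Tamagawa relation at every odd `p`
   (`X11b.padicValNat_tamagawaProduct_baseChange_quadratic_of_heegner_of_odd`, session 4) + "no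
   `p`-torsion at a non-anomalous Eisenstein `p`" (`not_dvd_torsionOrder_of_not_anom`, for `E` and for
   `E^K` via `partner_good_red_not_anom`) ⇒ the conclusion of (5.7) at `(E, p, K, Wd, q, q_d)`, with the
   DERIVED sign `[LHS] = −[RHS]` — the reading note `CGLS22-(5.7)-sign` is now a kernel computation.
3. `display57_of_display55` — **the named fact A149 (`display57_rankOne_twist`, all `p > 2`) is a
   THEOREM granted A157 + Gross–Zagier + Kolyvagin + GZK + modularity (parametrisation, `L`-function)**:
   the datum is produced by `nonempty_modularParametrizationData`, `exists_dvd_sq_sub_discr_holds`,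
   `nonempty_heegnerDatum_holds`, `heegnerPointComplex_mem_range_map_holds`. Every consumer of A149
   (session 2: CGS Thm. D `r = 1` re-assembled, CGLS Thm. F re-assembled, the per-pair iff) is thereby
   fed from A157: `bsdp_of_display55_of_cgsThmA` (CGS 2025 Thm. D, `r ≤ 1`, every odd `p`, from (5.5) +
   Thm. A), `bsdp_rankOne_of_display55_of_gvThm13` (CGLS22 Thm. F from (5.5) + GV Thm. 1.3 — the
   printed proof of Thm. 5.3.1 END TO END from (5.5)). For the referee: A149 can be carried as
   "derived from A157" (registry −1) with no consumer lost.

References: [CastellaGrossiLeeSkinner2022] proof of Thm. 5.3.1, (5.4)–(5.7), Thms. 5.1.1–5.1.4;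
[CastellaGrossiSkinner2025] Thm. A, Thm. D and its proof (§0.3 p. 5); [GrossZagier1986] I.(6.5), V.§2
(pp. 310–312); [JetchevSkinnerWan2017] §7.4.1 (eq:gz for K′, eq:tamK); [Gross1991] Thm. 1.3;
[GreenbergVatsal2000] Thm. (1.3); [GreenbergLNM1716] Thm. 4.1; [HoffsteinLuo1997]; [Miller2011LMS]
Def. 1.1. Deliverable: HOME/b2b-bsdres-lit-cgls/CGLS-GV-TYPING.md §11 (session 4).
-/

set_option autoImplicit false

noncomputable section

open scoped Classical MatrixGroups ModularForm

open CongruenceSubgroup WeierstrassCurve NumberField Literature.NumberTheory.EllipticCurves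
  Literature.NumberTheory.EllipticCurves.ModularForms Literature.NumberTheory.QuadraticFields
  Literature.NumberTheory.EllipticCurves.Rank1Residual
  Literature.NumberTheory.EllipticCurves.Rank1Residual.Typed
  Literature.NumberTheory.EllipticCurves.CastellaGrossiLeeSkinner2022
  Literature.NumberTheory.EllipticCurves.KrizLi2019

namespace Summit.BirchSwinnertonDyer.Rank1Residual

/-! ### §2 (5.5) + (5.6) ⇒ (5.7) at a datum, every odd `p` -/

/-- **(5.5) ⇒ (5.7) at one admissible `(E, p, K, Wd)` and one Heegner datum — "combining (5.5) and
(5.6) we arrive at (5.7)", IN THE KERNEL.** Data: `W/ℚ` globally minimal elliptic of conductor `N`,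
`p > 2` good with `E[p]` reducible and `a_p ≢ 1 (mod p)`, `ord_{s=1}L(E,s) = 1`; `K` admissible
((a) `d_K` odd `< −4`, (b) every `ℓ ∣ N` split, (c) `p` split, (d) `L(E^{(d_K)},1) ≠ 0`); a datum
`(Dt, H, ι, P)` of level `N` (ANY Manin constant: it cancels); `Wd` a globally minimal model of
`E^{(d_K)}`; the rationals `q`, `q_d` of (5.7). From (5.5) (`h55`, at this datum, with `Ш(E/K)` finite
by Kolyvagin), (5.6) (`TwistIdentity.padicValRat_add_eq_of_grossZagier`), the odd parts
`ord_p #Ш(E/K) = ord_p #Ш(E) + ord_p #Ш(E^K)` and `ord_p #E(K)_tors = ord_p #E(ℚ)_tors + ord_p #E^K(ℚ)_tors`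
(Kriz–Li descent lemmas), the Tamagawa relation `ord_p ∏_w c_w(E/K) = ord_p ∏c(E) + ord_p ∏c(E^K)` at
every odd `p` (`X11b.padicValNat_tamagawaProduct_baseChange_quadratic_of_heegner_of_odd`), and
`p ∤ #E(ℚ)_tors·#E^K(ℚ)_tors` at a non-anomalous Eisenstein `p` (`not_dvd_torsionOrder_of_not_anom`,
`partner_good_red_not_anom`): the conclusion of `display57_rankOne_twist` at this instance, with the
derived sign `[ord_p q − ord_p ∏c(E) − ord_p #Ш(E)] = −[ord_p q_d − ord_p ∏c(E^K) − ord_p #Ш(E^K)]`.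
[cite: CastellaGrossiLeeSkinner2022, proof of Thm. 5.3.1, displays (5.5)–(5.7) and the sentence between them]
[cite: GrossZagier1986, V.§2 (pp. 310–312)] [cite: JetchevSkinnerWan2017, §7.4.1] -/
theorem TwistIdentity.display57_at_of_display55 (h55 : display55_sha_heegnerIndex)
    (W : WeierstrassCurve ℚ) [W.IsElliptic] [W.IsGloballyMinimal] (p : ℕ) [Fact p.Prime]
    (N : ℕ) [NeZero N] (K : Type) [Field K] [NumberField K]
    (Dt : ModularParametrizationData W N) (H : HeegnerDatum N (NumberField.discr K)) (ι : K →+* ℂ)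
    (P : (W.baseChange K).toAffine.Point)
    (hGZ : gross_zagier N W K) (hKo : kolyvagin N W K)
    (hGZK : rank_eq_analyticRank_of_analyticRank_le_one) (hmod : hasEntireLFunction_rat)
    (hp : 2 < p) (hgood : Good W p) (hred : Red W p) (hna : ¬ Anom W p) (hr : W.analyticRank = 1)
    (hN : W.conductorNorm ℤ = N) (hK : IsImaginaryQuadratic K) (hodd : Odd (NumberField.discr K))
    (hlt : NumberField.discr K < -4) (hHN : SatisfiesHeegnerHypothesis N K)
    (hHp : SatisfiesHeegnerHypothesis p K)
    (hLt : (W.quadraticTwist (NumberField.discr K : ℚ)).entireLFunction 1 ≠ 0)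
    (hP : WeierstrassCurve.Affine.Point.map ι.toRatAlgHom P = heegnerPointComplex Dt H)
    (Wd : WeierstrassCurve ℚ) [Wd.IsElliptic] [Wd.IsGloballyMinimal]
    (hWd : ∃ C : VariableChange ℚ, C • Wd = W.quadraticTwist (NumberField.discr K : ℚ))
    (q qd : ℚ) (hq : W.leadingLCoeff / ((W.realPeriodRat * W.regulator : ℝ) : ℂ) = (q : ℂ))
    (hqd : Wd.entireLFunction 1 / (Wd.realPeriodRat : ℂ) = (qd : ℂ)) :
    padicValRat p q - padicValNat p W.tamagawaProduct - padicValNat p W.shaOrder =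
      -(padicValRat p qd - padicValNat p Wd.tamagawaProduct - padicValNat p Wd.shaOrder) := by
  have hpp : p.Prime := Fact.out
  have hp2 : p ≠ 2 := by omega
  haveI hEK : (W.baseChange K).IsElliptic := isElliptic_baseChange' W K
  have h2 : Module.finrank ℚ K = 2 := hK.1
  have hHN' : SatisfiesHeegnerHypothesis (W.conductorNorm ℤ) K := by rw [hN]; exact hHN
  have hD0 : (NumberField.discr K : ℚ) ≠ 0 := by exact_mod_cast NumberField.discr_ne_zero K
  haveI hEt : (W.quadraticTwist (NumberField.discr K : ℚ)).IsElliptic :=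
    W.isElliptic_quadraticTwist hD0
  -- the inverse change of variables `Cd • E^{(d_K)} = Wd`
  obtain ⟨C, hC⟩ := hWd
  set Cd : VariableChange ℚ := C⁻¹ with hCd_def
  have hCd : Cd • W.quadraticTwist (NumberField.discr K : ℚ) = Wd := by rw [← hC, inv_smul_smul]
  -- `p ∤ d_K` (split), `p ∤ w_K = 2` (`d_K < -4`), `ord_p u(Cd) = 0` (minimal twist, `p` split)
  have hpd : ¬ (p : ℤ) ∣ NumberField.discr K := not_dvd_discr_of_split hK hpp hp2 hHp
  have hμ : ¬ p ∣ Units.torsionOrder K := X2.not_dvd_unitsTorsionOrder_of_discr_lt hK hlt hpp hp2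
  have hu : padicValRat p (Cd.u : ℚ) = 0 :=
    AdditivePotMult.padicValRat_u_eq_zero_of_twist_minimal_of_split W p K hK hHp Cd hCd
  ---------------------------------------------------------------- Kolyvagin: `Ш(E/K)` finite, ranks
  have hL0 : W.entireLFunction 1 = 0 := entireLFunction_one_eq_zero_of_analyticRank_eq_one hr
  obtain ⟨-, hderiv⟩ := leadingLCoeff_eq_deriv_of_analyticRank_eq_one hr
  have hprod := lDerivEK_eq_deriv_mul W K hmod hL0
  have hLK : LDerivEK W K ≠ 0 := by
    rw [hprod]; exact mul_ne_zero hderiv hLt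
  have hPH : IsHeegnerPoint N W K P := ⟨Dt, H, ι, hP⟩
  have hPinf : ¬ IsOfFinAddOrder P :=
    (lDerivEK_ne_zero_iff_not_isOfFinAddOrder W N K hGZ hK hHN hPH).mp hLK
  obtain ⟨-, hShaK⟩ := hKo hK hHN hPH hPinf
  haveI hfinK : Finite (W.baseChange K).sha := hShaK
  haveI hfinW : Finite W.sha := Literature.NumberTheory.EllipticCurves.shaFinite_of_baseChange W K hShaK
  have hrt : (W.quadraticTwist (NumberField.discr K : ℚ)).analyticRank = 0 :=
    ((W.quadraticTwist _).analyticRank_eq_zero_iff_holds (hmod _)).2 hLt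
  have hrd : Wd.analyticRank = 0 := by rw [← hCd, analyticRank_smul, hrt]
  obtain ⟨hrankd, hShad⟩ := hGZK Wd (by omega)
  have hrkd : Wd.mordellWeilRank = 0 := by rw [hrankd, hrd]
  haveI hfind : Finite Wd.toAffine.Point := Wd.mordellWeilRank_eq_zero_iff_holds.mp hrkd
  haveI hfinSd : Finite Wd.sha := hShad
  have htdeq : Wd.torsionOrder = Nat.card Wd.toAffine.Point := Wd.torsionOrder_eq_natCard_of_finite
  ---------------------------------------------------------------- (5.5) at the datum
  have h5 := h55 W p hp hgood hred hna hr K hK hodd hlt hHN' hHp hLt N Dt H ι P hP hfinK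
  ---------------------------------------------------------------- (5.6) `p`-adically
  have h6 := TwistIdentity.padicValRat_add_eq_of_grossZagier W p N K Dt H ι P hGZ hKo hGZK hmod hK hHN
    hP hp2 hμ hr hLt Wd Cd hCd hu q qd hq hqd
  ---------------------------------------------------------------- the odd parts under `K/ℚ`
  -- torsion: `v_p(t_K) = v_p(t_W) + v_p(t_d)`
  obtain ⟨θ, c, hθ, hcθ⟩ := Quadratic.exists_sq_eq_algebraMap (F := ℚ) (K := K) h2
  obtain ⟨qq, hqq, hdq⟩ := NumberField.exists_discr_eq_mul_sq h2 hθ hcθ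
  have htors : padicValNat p (W.baseChange K).torsionOrder =
      padicValNat p W.torsionOrder + padicValNat p (Nat.card Wd.toAffine.Point) :=
    padicValNat_torsionOrder_baseChange_quadratic W K h2 hθ hcθ hqq hdq ⟨Cd, hCd⟩ p hp2
  -- `Ш`: `v_p(#Ш(E/K)) = v_p(#Ш(E)) + v_p(#Ш(E^K))`
  have hsha : padicValNat p (W.baseChange K).shaOrder =
      padicValNat p W.shaOrder + padicValNat p Wd.shaOrder := by
    have hcard := card_primaryComponent_sha_baseChange_quadratic_of_odd_of_finite W K h2 Wd
      ⟨Cd, hCd⟩ (W.baseChange K) ⟨1, one_smul _ _⟩ p hp2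
    rw [WeierstrassCurve.shaOrder, WeierstrassCurve.shaOrder, WeierstrassCurve.shaOrder,
      ← (Nat.pow_right_injective hpp.two_le).eq_iff, pow_add,
      ← natCard_primaryComponent_eq_pow_padicValNat p, ← natCard_primaryComponent_eq_pow_padicValNat p,
      ← natCard_primaryComponent_eq_pow_padicValNat p]
    exact hcard
  -- Tamagawa: `v_p(∏_w c_w(E/K)) = v_p(∏c(E)) + v_p(∏c(E^K))` at the odd `p ∤ d_K`
  have htam : padicValNat p (W.baseChange K).tamagawaProduct =
      padicValNat p W.tamagawaProduct + padicValNat p Wd.tamagawaProduct :=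
    X11b.padicValNat_tamagawaProduct_baseChange_quadratic_of_heegner_of_odd W p K Wd hp2 hK hodd hpd
      hHN' hCd
  ---------------------------------------------------------------- no `p`-torsion at a non-anomalous Eisenstein `p`
  obtain ⟨hgood_d, -, hna_d⟩ := partner_good_red_not_anom hp hgood hred hna K hK hodd hHp Wd ⟨C, hC⟩
  have ht : padicValNat p W.torsionOrder = 0 :=
    padicValNat.eq_zero_of_not_dvd (not_dvd_torsionOrder_of_not_anom W p hp hgood hna)
  have htd : padicValNat p Wd.torsionOrder = 0 :=
    padicValNat.eq_zero_of_not_dvd (not_dvd_torsionOrder_of_not_anom Wd p hp hgood_d hna_d)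
  rw [htdeq] at htd
  ---------------------------------------------------------------- combine
  omega

/-! ### §3 The named fact (5.7) is a theorem granted (5.5) and the published Heegner-point facts -/

/-- **A149 from A157: `display57_rankOne_twist` (CGLS22 display (5.7), every `p > 2`) DERIVED from
`display55_sha_heegnerIndex` (display (5.5)) + Gross–Zagier (`hGZ`) + Kolyvagin (`hKo`) + GZK
(`hGZK`) + modularity (`hmodP`: a parametrisation datum of level `N_E`; `hmod`: the entire
`L`-function / Artin formalism).** The Heegner datum demanded by (5.5) is PRODUCED: `Dt` by
`nonempty_modularParametrizationData`, a Heegner form by `exists_dvd_sq_sub_discr_holds` /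
`nonempty_heegnerDatum_holds` (tree theorems under the Heegner hypothesis), an embedding `K → ℂ`, and the
`K`-rational Heegner point by `heegnerPointComplex_mem_range_map_holds` (tree theorem); then
`TwistIdentity.display57_at_of_display55`. For the registry: every consumer of A149 is a consumer of A157
plus these published facts. [cite: CastellaGrossiLeeSkinner2022, proof of Thm. 5.3.1, "combining (5.5) and (5.6) we arrive at (5.7)"]
[cite: GrossZagier1986, I.(6.5), V.§2] [cite: Gross1991, Thm. 1.3] -/
theorem display57_of_display55 (h55 : display55_sha_heegnerIndex)
    (hmodP : nonempty_modularParametrizationData)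
    (hGZ : ∀ (N : ℕ) [NeZero N] (W : WeierstrassCurve ℚ) (K : Type) [Field K] [NumberField K],
      gross_zagier N W K)
    (hKo : ∀ (N : ℕ) [NeZero N] (W : WeierstrassCurve ℚ) (K : Type) [Field K] [NumberField K],
      kolyvagin N W K)
    (hGZK : rank_eq_analyticRank_of_analyticRank_le_one) (hmod : hasEntireLFunction_rat) :
    display57_rankOne_twist := by
  intro W _ _ p _ hp hgood hred hna hr K _ _ hK hodd hlt hHN hHp hLt Wd _ _ hWd q qd hq hqd
  haveI : NeZero (W.conductorNorm ℤ) := ⟨(W.conductorNorm_pos_holds).ne'⟩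
  obtain ⟨Dt⟩ := hmodP W
  obtain ⟨β, hβ⟩ := exists_dvd_sq_sub_discr_holds (W.conductorNorm ℤ) K hK hHN
  obtain ⟨H, -⟩ := nonempty_heegnerDatum_holds (W.conductorNorm ℤ) K hK hβ
  obtain ⟨ι⟩ : Nonempty (K →+* ℂ) := inferInstance
  obtain ⟨P, hP⟩ := heegnerPointComplex_mem_range_map_holds (W.conductorNorm ℤ) W K hK hHN Dt H ι
  exact TwistIdentity.display57_at_of_display55 h55 W p (W.conductorNorm ℤ) K Dt H ι P (hGZ _ W K)
    (hKo _ W K) hGZK hmod hp hgood hred hna hr rfl hK hodd hlt hHN hHp hLt hP Wd hWd q qd hq hqd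

/-- Modularity in the `exists_isNewformOf` spelling feeds both `hmod` binders above. [folklore] -/
theorem display57_of_display55' (h55 : display55_sha_heegnerIndex)
    (hmodP : nonempty_modularParametrizationData) (hnf : exists_isNewformOf)
    (hGZ : ∀ (N : ℕ) [NeZero N] (W : WeierstrassCurve ℚ) (K : Type) [Field K] [NumberField K],
      gross_zagier N W K)
    (hKo : ∀ (N : ℕ) [NeZero N] (W : WeierstrassCurve ℚ) (K : Type) [Field K] [NumberField K],
      kolyvagin N W K)
    (hGZK : rank_eq_analyticRank_of_analyticRank_le_one) : display57_rankOne_twist :=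
  display57_of_display55 h55 hmodP hGZ hKo hGZK (hasEntireLFunction_rat_of_exists_isNewformOf hnf)

/-! ### §4 The consumers of (5.7), now fed from (5.5) -/

/-- **CGS 2025 Thm. D (`r ∈ {0,1}`) at EVERY odd good non-anomalous Eisenstein `p`, from the typed
display (5.5) and the typed Theorem A** — session 2's `bsdp_of_display57_of_thmA` with its A149
binder discharged by `display57_of_display55'`. Inputs: (5.5) (`h55`), Theorem A (`hA`), Greenberg
Thm. 4.1, modularity, Hoffstein–Luo, Gross–Zagier (both currencies: `gross_zagier` over `K` for (5.6),
`GrossZagier1986_thm_I_7_3` over `ℚ` for the rationality of `q`), Kolyvagin, GZK — every one a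
published named fact of the tree; no `_OPEN` binder, no per-pair binder, no `p ≥ 5`.
[cite: CastellaGrossiSkinner2025, Thm. D (= "Thm. 4") and its proof (§0.3 p. 5), Theorem A]
[cite: CastellaGrossiLeeSkinner2022, proof of Thm. 5.3.1, (5.5)–(5.7)] -/
theorem RowC6.bsdp_of_display55_of_cgsThmA (h55 : display55_sha_heegnerIndex)
    (hA : CastellaGrossiSkinner2025.thmA_charIdeal_eq_padicLFunction)
    (hGr : greenberg_charValue_rankZero) (hmodP : nonempty_modularParametrizationData)
    (hnf : exists_isNewformOf) (hHL : HoffsteinLuo1997_exists_twist_L_one_ne_zero)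
    (hGZQ : GrossZagier1986_thm_I_7_3)
    (hGZ : ∀ (N : ℕ) [NeZero N] (W : WeierstrassCurve ℚ) (K : Type) [Field K] [NumberField K],
      gross_zagier N W K)
    (hKo : ∀ (N : ℕ) [NeZero N] (W : WeierstrassCurve ℚ) (K : Type) [Field K] [NumberField K],
      kolyvagin N W K)
    (hGZK : rank_eq_analyticRank_of_analyticRank_le_one)
    (W : WeierstrassCurve ℚ) [W.IsElliptic] [W.IsGloballyMinimal] (p : ℕ) [Fact p.Prime]
    (hp : 2 < p) (hgood : Good W p) (hred : Red W p) (hna : ¬ Anom W p) (hr : W.analyticRank ≤ 1) :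
    BSDp W p :=
  bsdp_of_display57_of_thmA (display57_of_display55' h55 hmodP hnf hGZ hKo hGZK) hA hGr hmodP hnf hHL
    hGZQ hGZK W p hp hgood hred hna hr

/-- **CGLS22 Theorem F (= Thm. 5.3.1) re-assembled from its printed proof END TO END starting at
(5.5)**: session 2's `bsdp_rankOne_of_display57_of_gvThm13` ((5.7) + Greenberg–Vatsal Thm. 1.3 on the
partner) with the (5.7) binder discharged from (5.5). Hypotheses = Thm. F's two bullets
(`a_p ≢ 1 (mod p)`; a rational line of character (ramified ∧ odd) ∨ (unramified ∧ even)) and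
`ord_{s=1}L(E,s) = 1`; NO Castella–Grossi–Skinner 2025 input (outside the `CGS25-BST-Thm311` flag).
[cite: CastellaGrossiLeeSkinner2022, Theorem F = Thm. 5.3.1 and its proof ((5.4)–(5.7), last paragraph)]
[cite: GreenbergVatsal2000, Thm. (1.3)] [cite: GreenbergLNM1716, Thm. 4.1 (p. 102)] -/
theorem RowC6.bsdp_rankOne_of_display55_of_gvThm13 (h55 : display55_sha_heegnerIndex)
    (hGV : GreenbergVatsal2000.thm13_charIdeal_eq_of_gvPar) (hGr : greenberg_charValue_rankZero)
    (hmodP : nonempty_modularParametrizationData) (hnf : exists_isNewformOf)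
    (hHL : HoffsteinLuo1997_exists_twist_L_one_ne_zero) (hGZQ : GrossZagier1986_thm_I_7_3)
    (hGZ : ∀ (N : ℕ) [NeZero N] (W : WeierstrassCurve ℚ) (K : Type) [Field K] [NumberField K],
      gross_zagier N W K)
    (hKo : ∀ (N : ℕ) [NeZero N] (W : WeierstrassCurve ℚ) (K : Type) [Field K] [NumberField K],
      kolyvagin N W K)
    (hGZK : rank_eq_analyticRank_of_analyticRank_le_one)
    (W : WeierstrassCurve ℚ) [W.IsElliptic] [W.IsGloballyMinimal] (p : ℕ) [Fact p.Prime]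
    (hp : 2 < p) (hgood : Good W p) (hred : Red W p) (hna : ¬ Anom W p)
    (hco : ∃ Φ : AddSubgroup (geomTorsion W (p : ℤ)), IsRationalLine W p Φ ∧
      ((¬ LineUnramifiedAt W p Φ ∧ LineOdd W p Φ) ∨ (LineUnramifiedAt W p Φ ∧ LineEven W p Φ)))
    (hr : W.analyticRank = 1) : BSDp W p :=
  bsdp_rankOne_of_display57_of_gvThm13 (display57_of_display55' h55 hmodP hnf hGZ hKo hGZK) hGV hGr
    hmodP hnf hHL hGZQ hGZK W p hp hgood hred hna hco hr

/-- **Theorem F on the type-A sub-locus `¬ GVPar W p`, from (5.5)** (the spelling of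
`Rank1Residual.bsdp_of_thmF_of_not_gvPar`). [cite: CastellaGrossiLeeSkinner2022, Theorem F = Thm. 5.3.1 and its proof]
[cite: GreenbergVatsal2000, Thm. (1.3)] -/
theorem RowC6.bsdp_rankOne_of_display55_of_gvThm13_of_not_gvPar (h55 : display55_sha_heegnerIndex)
    (hGV : GreenbergVatsal2000.thm13_charIdeal_eq_of_gvPar) (hGr : greenberg_charValue_rankZero)
    (hmodP : nonempty_modularParametrizationData) (hnf : exists_isNewformOf)
    (hHL : HoffsteinLuo1997_exists_twist_L_one_ne_zero) (hGZQ : GrossZagier1986_thm_I_7_3)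
    (hGZ : ∀ (N : ℕ) [NeZero N] (W : WeierstrassCurve ℚ) (K : Type) [Field K] [NumberField K],
      gross_zagier N W K)
    (hKo : ∀ (N : ℕ) [NeZero N] (W : WeierstrassCurve ℚ) (K : Type) [Field K] [NumberField K],
      kolyvagin N W K)
    (hGZK : rank_eq_analyticRank_of_analyticRank_le_one)
    (W : WeierstrassCurve ℚ) [W.IsElliptic] [W.IsGloballyMinimal] (p : ℕ) [Fact p.Prime]
    (hp : 2 < p) (hgood : Good W p) (hred : Red W p) (hna : ¬ Anom W p) (hnpar : ¬ GVPar W p)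
    (hr : W.analyticRank = 1) : BSDp W p :=
  bsdp_rankOne_of_display57_of_gvThm13_of_not_gvPar (display57_of_display55' h55 hmodP hnf hGZ hKo hGZK)
    hGV hGr hmodP hnf hHL hGZQ hGZK W p hp hgood hred hna hnpar hr

end Summit.BirchSwinnertonDyer.Rank1Residual

end
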